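import Literature.NumberTheory.EllipticCurves.WeightOneEtaQuotientsProofs
import HarnessLib

/-!
# The cusp form `η(2τ)¹² ∈ S₆(Γ₀(4))`

Topic `NumberTheory/EllipticCurves` (modular forms for `Γ₀(N)`), namespace
`Literature.NumberTheory.EllipticCurves.ModularForms`.  Definitions with bodies, all statements
proved, no named fact.  Companion of `EtaOcticLevelNine.lean` (`η(3τ)⁸ ∈ S₄(Γ₀(9))`), with the same
method:

* `etaDuodecicFour = η(2τ)¹²`, realised as `(η²|₁D₂)⁶` with the tree's `etaSq`, `tpD`
  (`ModularCurveEtaProductsProofs`): `Γ₀(4)`-invariant in weight `6`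
  (`etaDuodecicFour_slash_of_mem` — by `etaSq_slash_tpD_slash` each factor `η(2τ)²` picks up
  `e^{πi e/6}` under `γ = (p q; 4k s)`, `e = e(p, 2q, 2k, s)`, and `e` is even because `s` is odd,
  `two_dvd_etaSqExp_level_four`), holomorphic, vanishing at every cusp; whence
  **`cuspFormEtaDuodecicFour : CuspForm (Gamma0 4) 6`** and `etaDuodecicFourForm`, nonzero and
  non-vanishing on `ℍ`; `Gamma0_four_le_two`.

`η(2τ)¹²` is the denominator of Weber's `γ₃(2τ) = E₆(2τ)/η(2τ)¹² ∈ ℂ(X₀(4))`, `γ₃² = j − 1728`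
(Cox, *Primes of the form x² + ny²*, §12.B), the modular function behind the square-root statement
for `j(τ₀) − 1728` needed for the complex-multiplication input of
`Literature.Barriers.ABC.OWeakUniformABCImpliesNoSiegelZeros`.

## References

* F. Diamond, J. Shurman, *A First Course in Modular Forms*, GTM 228, 2005, §1.2, §3.2.
  [DiamondShurman2005]
* D. A. Cox, *Primes of the form x² + ny²*, 2nd ed., 2013, §12.B (Weber's `γ₃`). [Cox2013]
-/

noncomputable section

open UpperHalfPlane hiding I
open Complex ModularForm CongruenceSubgroup Matrix.SpecialLinearGroup
open scoped MatrixGroups Real ModularForm Manifold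

namespace Literature.NumberTheory.EllipticCurves.ModularForms

/-- `Γ₀(4) ≤ Γ₀(2)` (the tree's `gamma0_le_gamma0_of_dvd`). [folklore] -/
theorem Gamma0_four_le_two : Gamma0 4 ≤ Gamma0 2 :=
  gamma0_le_gamma0_of_dvd (by norm_num : 2 ∣ 4)

/-- The exponent of the multiplier of `η(2τ)²` under `γ = (p q; 4k s) ∈ Γ₀(4)` is even:
`e(p, 2q, 2k, s) = 2·(…)` as soon as `s` is odd (which `ps − 4qk = 1` forces). [folklore] -/
theorem two_dvd_etaSqExp_level_four {p q k s : ℤ} (hs : Odd s) :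
    (2 : ℤ) ∣ etaSqExp p (2 * q) (2 * k) s := by
  obtain ⟨t, rfl⟩ := hs
  refine ⟨(1 - (2 * k) ^ 2) * (q * (2 * t + 1) + 3 * k * (2 * t + 1) + k - 3 * t) +
    (k * p + k * (2 * t + 1) - 3 * k), ?_⟩
  simp only [etaSqExp]
  ring

/-- `φ₄(τ) = η(2τ)¹²`, realised as `(η²|₁D₂)⁶`. [folklore] -/
def etaDuodecicFour : ℍ → ℂ :=
  (etaSq ∣[(1 : ℤ)] tpD 2) * (etaSq ∣[(1 : ℤ)] tpD 2) * (etaSq ∣[(1 : ℤ)] tpD 2) *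
    (etaSq ∣[(1 : ℤ)] tpD 2) * (etaSq ∣[(1 : ℤ)] tpD 2) * (etaSq ∣[(1 : ℤ)] tpD 2)

/-- `φ₄(τ) = η(2τ)¹²`. [folklore] -/
theorem etaDuodecicFour_apply (τ : ℍ) : etaDuodecicFour τ = η (2 * (τ : ℂ)) ^ 12 := by
  simp only [etaDuodecicFour, Pi.mul_apply, etaSq_slash_tpD_apply]
  push_cast
  ring

/-- `φ₄(τ) ≠ 0` on `ℍ`. [folklore] -/
theorem etaDuodecicFour_ne_zero (τ : ℍ) : etaDuodecicFour τ ≠ 0 := by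
  rw [etaDuodecicFour_apply]
  refine pow_ne_zero _ (ModularForm.eta_ne_zero ?_)
  simpa using mul_pos (by norm_num : (0 : ℝ) < 2) τ.2

/-- **`φ₄ = η(2τ)¹²` is `Γ₀(4)`-invariant in weight `6`**: each factor `η(2τ)²` picks up
`e^{πi e/6}` with `e` even, so the product picks up `e^{πi e} = 1`. [folklore] -/
theorem etaDuodecicFour_slash_of_mem {γ : SL(2, ℤ)} (hγ : γ ∈ Gamma0 4) :
    etaDuodecicFour ∣[(6 : ℤ)] γ = etaDuodecicFour := by
  rw [Gamma0_mem] at hγ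
  obtain ⟨k, hk⟩ := (ZMod.intCast_zmod_eq_zero_iff_dvd _ 4).mp hγ
  have hc : γ 1 0 = ((2 : ℕ) : ℤ) * (2 * k) := by rw [hk]; push_cast; ring
  have hdet : γ 0 0 * γ 1 1 - γ 0 1 * γ 1 0 = 1 := by
    have := Matrix.det_fin_two (γ : Matrix (Fin 2) (Fin 2) ℤ)
    rw [γ.det_coe] at this
    linarith
  have hs : Odd (γ 1 1) := by
    refine Int.not_even_iff_odd.mp ?_
    rintro ⟨t, ht⟩
    rw [hk, ht] at hdet
    have h2 : (2 : ℤ) ∣ 1 := ⟨γ 0 0 * t - γ 0 1 * (2 * k), by linear_combination -hdet⟩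
    omega
  set f := etaSq ∣[(1 : ℤ)] tpD 2 with hf
  have h1 : f ∣[(1 : ℤ)] (γ : GL (Fin 2) ℝ) =
      cexp (π * I / 6 * etaSqExp (γ 0 0) (2 * γ 0 1) (2 * k) (γ 1 1)) • f := by
    have := etaSq_slash_tpD_slash 2 hc
    simpa using this
  set c : ℂ := cexp (π * I / 6 * etaSqExp (γ 0 0) (2 * γ 0 1) (2 * k) (γ 1 1)) with hcdef
  have hc6 : c ^ 6 = 1 := by
    obtain ⟨m, hm⟩ := two_dvd_etaSqExp_level_four (p := γ 0 0) (q := γ 0 1) (k := k) hs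
    rw [hcdef, ← Complex.exp_nat_mul, hm]
    push_cast
    rw [show (6 : ℂ) * (π * I / 6 * (2 * (m : ℂ))) = m * (2 * π * I) by ring]
    exact Complex.exp_int_mul_two_pi_mul_I m
  have h2 := ModularForm.mul_slash_SL2 1 1 γ f f
  have h3 := ModularForm.mul_slash_SL2 2 1 γ (f * f) f
  have h4 := ModularForm.mul_slash_SL2 3 1 γ (f * f * f) f
  have h5 := ModularForm.mul_slash_SL2 4 1 γ (f * f * f * f) f
  have h6 := ModularForm.mul_slash_SL2 5 1 γ (f * f * f * f * f) f
  rw [show (1 : ℤ) + 1 = 2 by norm_num] at h2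
  rw [show (2 : ℤ) + 1 = 3 by norm_num] at h3
  rw [show (3 : ℤ) + 1 = 4 by norm_num] at h4
  rw [show (4 : ℤ) + 1 = 5 by norm_num] at h5
  rw [show (5 : ℤ) + 1 = 6 by norm_num] at h6
  rw [etaDuodecicFour, ← hf, h6, h5, h4, h3, h2, ModularForm.SL_slash, h1]
  ext τ
  simp only [Pi.mul_apply, Pi.smul_apply, smul_eq_mul]
  have : c * f τ * (c * f τ) * (c * f τ) * (c * f τ) * (c * f τ) * (c * f τ) =
      c ^ 6 * (f τ * f τ * f τ * f τ * f τ * f τ) := by ring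
  rw [this, hc6, one_mul]

/-- `φ₄` is holomorphic on `ℍ`. [folklore] -/
theorem mdifferentiable_etaDuodecicFour : MDifferentiable 𝓘(ℂ) 𝓘(ℂ) etaDuodecicFour :=
  (((((mdifferentiable_etaSq.slash _ _).mul (mdifferentiable_etaSq.slash _ _)).mul
    (mdifferentiable_etaSq.slash _ _)).mul (mdifferentiable_etaSq.slash _ _)).mul
    (mdifferentiable_etaSq.slash _ _)).mul (mdifferentiable_etaSq.slash _ _)

/-- All `SL₂(ℤ)`-translates of `φ₄` vanish at `i∞`. [folklore] -/
theorem isZeroAtImInfty_etaDuodecicFour_slash (γ : SL(2, ℤ)) :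
    IsZeroAtImInfty (etaDuodecicFour ∣[(6 : ℤ)] (γ : GL (Fin 2) ℝ)) := by
  set f := etaSq ∣[(1 : ℤ)] tpD 2 with hf
  have h2 := ModularForm.mul_slash_SL2 1 1 γ f f
  have h3 := ModularForm.mul_slash_SL2 2 1 γ (f * f) f
  have h4 := ModularForm.mul_slash_SL2 3 1 γ (f * f * f) f
  have h5 := ModularForm.mul_slash_SL2 4 1 γ (f * f * f * f) f
  have h6 := ModularForm.mul_slash_SL2 5 1 γ (f * f * f * f * f) f
  rw [show (1 : ℤ) + 1 = 2 by norm_num] at h2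
  rw [show (2 : ℤ) + 1 = 3 by norm_num] at h3
  rw [show (3 : ℤ) + 1 = 4 by norm_num] at h4
  rw [show (4 : ℤ) + 1 = 5 by norm_num] at h5
  rw [show (5 : ℤ) + 1 = 6 by norm_num] at h6
  simp only [ModularForm.SL_slash] at h2 h3 h4 h5 h6
  rw [etaDuodecicFour, ← hf, h6, h5, h4, h3, h2]
  have h0 := isZeroAtImInfty_etaSq_slash_tpD_slash 2 γ
  have h := ((((h0.mul h0).mul h0).mul h0).mul h0).mul h0
  simp only [mul_zero] at h
  exact h

/-- **The cusp form `η(2τ)¹² ∈ S₆(Γ₀(4))`**, its modularity proved from the multiplier system of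
`η²`.  (Remark, not used or proved here: classically the normalised newform of `S₆(Γ₀(4))`.) [folklore] -/
def cuspFormEtaDuodecicFour : CuspForm (Gamma0 4) 6 where
  toFun := etaDuodecicFour
  slash_action_eq' A hA := by
    obtain ⟨γ, hγ, rfl⟩ := hA
    exact etaDuodecicFour_slash_of_mem hγ
  holo' := mdifferentiable_etaDuodecicFour
  zero_at_cusps' hc := by
    rw [Subgroup.IsArithmetic.isCusp_iff_isCusp_SL2Z] at hc
    rw [OnePoint.isZeroAt_iff_forall_SL2Z hc]
    intro γ _
    exact isZeroAtImInfty_etaDuodecicFour_slash γ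

/-- The underlying function of `cuspFormEtaDuodecicFour`. [folklore] -/
@[simp] theorem coe_cuspFormEtaDuodecicFour :
    (cuspFormEtaDuodecicFour : ℍ → ℂ) = etaDuodecicFour := rfl

/-- `η(2τ)¹²` as a modular form of weight `6` for `Γ₀(4)`. [folklore] -/
def etaDuodecicFourForm : ModularForm (Gamma0 4) 6 :=
  ModularFormClass.modularForm cuspFormEtaDuodecicFour

/-- `etaDuodecicFourForm τ = η(2τ)¹²`. [folklore] -/
@[simp] theorem etaDuodecicFourForm_apply (τ : ℍ) :
    etaDuodecicFourForm τ = η (2 * (τ : ℂ)) ^ 12 := by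
  rw [← etaDuodecicFour_apply]; rfl

/-- `etaDuodecicFourForm ≠ 0`. [folklore] -/
theorem etaDuodecicFourForm_ne_zero : etaDuodecicFourForm ≠ 0 := by
  intro h
  have := congrArg (fun f : ModularForm (Gamma0 4) 6 ↦ f UpperHalfPlane.I) h
  rw [etaDuodecicFourForm_apply] at this
  simp only [ModularForm.zero_apply] at this
  exact absurd this (by rw [← etaDuodecicFour_apply]; exact etaDuodecicFour_ne_zero _)

end Literature.NumberTheory.EllipticCurves.ModularForms

end
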